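import Summits.Ventures.HodgeKum4.Theorems.KummerFixedLocusHilbertKummerTransferCover
import Literature.AlgebraicGeometry.HodgeTheory.GysinBaseChange
import Literature.Algebra.Lie.Sl2Intertwiner
import Literature.AlgebraicGeometry.Surfaces.K3LatticeInvariantsProofs
import HarnessLib

/-!
# V0 (`HilbertKummerTransfer`) — the class `Θ^*ℓ` splits, and the fibre range `R = im θ^*` is an `(L_{θ^*ℓ}, h,
# Λ)`-submodule of `H*(K(ℂ); ℂ)` (cell `hodge-kum4`, lane (V), seat p2)

Route `KummerFixedLocus`, item `HilbertKummerTransfer` (stmt-Ventures-20142).  HONEST FRAMING: helper theorems for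
V0; nothing about V0, L1 or the Hodge conjecture is proved in this file.

For Beauville's cover `Θ = kummerCover act j : A × K ⟶ H` (a translation action on a Hilbert scheme of points of the
abelian surface `A` and a Kummer fibre `j : K ⟶ H`):

* §1 **`exists_map_kummerCover_two_eq`** — if `b₁(K) = 0` then `Θ^* ℓ = fst^* x + snd^* (θ^* ℓ)` in `H²((A × K)(ℂ))`
  for some `x ∈ H²(A(ℂ))` and EVERY `ℓ ∈ H²(H(ℂ))` (Künneth in degree `2`: the `H¹ ⊗ H¹` term vanishes, `H⁰ = ℂ·1` on
  both sides; the `K`-component is read off on the slice `(1, 𝟙_K)`, where `Θ` restricts to `θ = j`).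
* §2 the fibre range `R = fibreRange A K Θ` (`= im θ^*`, file `…Cover`): contains `1` and `θ^* ℓ`, is cup-closed,
  stable under the degree operator and — for every `𝔰𝔩₂`-triple `(L_{θ^*ℓ}, h, Λ_K)` on `H*(K)` — **stable under
  `Λ_K`** (`fibreRange_lambda_mem`): each deck factor `τ_g^*` fixes `θ^* ℓ`, preserves degrees and cup products, so
  it intertwines `(h, L)` with itself and therefore commutes with `Λ_K` (naturality of the `𝔰𝔩₂`-partner,
  `Algebra.Lie.comp_dual_eq_dual_comp_of_isSl2Triple`), while `R = {s | τ_g^* s = s ∀ g}`.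
* §3 small facts: `degreeOperator K 0 = 0` for `K` of dimension `0` (so V0 is vacuous at `n = 0`), `h_K ≠ 0` on `R`
  for `n ≥ 1`.
-/

noncomputable section

open CategoryTheory MonoidalCategory CartesianMonoidalCategory DirectSum TensorProduct
open Literature.AlgebraicTopology.SingularHomology
open Literature.AlgebraicGeometry Literature.AlgebraicGeometry.Motives Literature.AlgebraicGeometry.Hyperkaehler
open Literature.AlgebraicGeometry.HilbertScheme Literature.AlgebraicGeometry.HodgeTheory

namespace Summit.Ventures.HodgeKum4.HilbertKummer

open scoped MonObj

variable {A : AbelianVariety ℂ} {K H : SchemeOver ℂ} {n m : ℕ} {Ξ : (A.X ⊗ H).left.IdealSheafData}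
  {act : A.X ⊗ H ⟶ H} {j : K ⟶ H}

/-! ### §1 `Θ^* ℓ = fst^* x + snd^* θ^* ℓ` -/

/-- **Künneth in degree `2` with `b₁(K) = 0`**: every class of `H²((A × K)(ℂ))` is `fst^* x + snd^* y` (`A`, `K`
smooth projective, `H¹(K(ℂ); ℂ) = 0`; the `(2,0)` and `(0,2)` Künneth components, `H⁰ = ℂ · 1` on both factors). -/
theorem exists_eq_map_fst_add_map_snd (hS : IsSmoothProjective 2 A.X) (hK : IsSmoothProjective m K)
    (h1 : ∀ w : complexBetti K 1, w = 0) (z : complexBetti (A.X ⊗ K) 2) :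
    ∃ (x : complexBetti A.X 2) (y : complexBetti K 2),
      z = complexBetti.map (fst A.X K) 2 x + complexBetti.map (snd A.X K) 2 y := by
  -- the target submodule
  let T : Submodule ℂ (complexBetti (A.X ⊗ K) 2) :=
    LinearMap.range (complexBetti.map (fst A.X K) 2).hom ⊔ LinearMap.range (complexBetti.map (snd A.X K) 2).hom
  suffices hz : z ∈ T by
    obtain ⟨u, ⟨x, rfl⟩, v, ⟨y, rfl⟩, rfl⟩ := Submodule.mem_sup.1 hz
    exact ⟨x, y, rfl⟩
  refine (Submodule.span_le.2 ?_) (kunnethSpan_complexBetti hS hK 2 z)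
  rintro _ ⟨i, j', h, b, w, rfl⟩
  -- `i ∈ {0, 1, 2}`
  rcases Nat.lt_or_ge i 3 with hi | hi
  · interval_cases i
    · -- `(0, 2)`: `b = c • 1`
      obtain rfl : j' = 2 := by omega
      obtain ⟨c', rfl⟩ := exists_eq_smul_one_of_isSmoothProjective hS ℂ b
      refine Submodule.mem_sup_right ⟨c' • w, ?_⟩
      rw [map_smul, map_smul, singularCohomology.map_one, LinearMap.map_smul₂, one_cupProduct]
    · -- `(1, 1)`: `w = 0`
      obtain rfl : j' = 1 := by omega
      rw [h1 w, map_zero, map_zero]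
      exact T.zero_mem
    · -- `(2, 0)`: `w = c • 1`
      obtain rfl : j' = 0 := by omega
      obtain ⟨c', rfl⟩ := exists_eq_smul_one_of_isSmoothProjective hK ℂ w
      refine Submodule.mem_sup_left ⟨c' • b, ?_⟩
      rw [map_smul, map_smul, singularCohomology.map_one, map_smul, cupProduct_one]
  · omega

/-- **`Θ^* ℓ = fst^* x + snd^* (θ^* ℓ)`** for the Kummer cover `Θ` of a translation action on a Hilbert scheme of
points of `A` and a Kummer fibre `j : K ⟶ H` with `b₁(K) = 0`: the `K`-component of `Θ^* ℓ` is `θ^* ℓ` because `Θ`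
restricts to `θ = j` on the slice `(1, 𝟙_K)` (`t_1^{[n]} = 𝟙`), on which `fst` is constant. -/
theorem exists_map_kummerCover_two_eq (hS : IsSmoothProjective 2 A.X) (hK : IsSmoothProjective m K)
    (hH : IsHilbertSchemeOfPoints n A.X H Ξ) (hact : IsTranslationAction Ξ act) (h1 : ∀ w : complexBetti K 1, w = 0)
    (ℓ : complexBetti H 2) :
    ∃ x : complexBetti A.X 2, complexBetti.map (kummerCover act j) 2 ℓ =
      complexBetti.map (fst A.X K) 2 x + complexBetti.map (snd A.X K) 2 (complexBetti.map j 2 ℓ) := by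
  obtain ⟨x, y, hxy⟩ := exists_eq_map_fst_add_map_snd hS hK h1 (complexBetti.map (kummerCover act j) 2 ℓ)
  refine ⟨x, ?_⟩
  -- read off `y` on the slice `(1, 𝟙_K)`
  have hslice := congrArg (complexBetti.map (Motives.sliceRight (1 : 𝟙_ (SchemeOver ℂ) ⟶ A.X) K) 2) hxy
  have hj : complexBetti.map (Motives.sliceRight (1 : 𝟙_ (SchemeOver ℂ) ⟶ A.X) K) 2
      (complexBetti.map (kummerCover act j) 2 ℓ) = complexBetti.map j 2 ℓ := by
    rw [← ModuleCat.comp_apply, Motives.sliceRight, hact.complexBetti_map_kummerCover_comp_sliceOne hH j]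
  have hfst : complexBetti.map (Motives.sliceRight (1 : 𝟙_ (SchemeOver ℂ) ⟶ A.X) K) 2
      (complexBetti.map (fst A.X K) 2 x) = 0 := by
    rw [← ModuleCat.comp_apply, ← complexBetti.map_comp, complexBetti.map, AlgPoints.mapContinuous_comp,
      mapContinuous_sliceRight_fst]
    exact singularCohomology_map_const two_ne_zero _ x
  have hsnd : complexBetti.map (Motives.sliceRight (1 : 𝟙_ (SchemeOver ℂ) ⟶ A.X) K) 2
      (complexBetti.map (snd A.X K) 2 y) = y := by
    rw [← ModuleCat.comp_apply, ← complexBetti.map_comp, Motives.sliceRight, lift_snd, complexBetti.map_id]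
    rfl
  rw [map_add, hj, hfst, hsnd, zero_add] at hslice
  rw [hxy, hslice]

/-- Total-cohomology form: `Θ^* ℓ = fst^* x + snd^* (θ^* ℓ)` in `H*((A × K)(ℂ))`. -/
theorem exists_totalPullback_kummerCover_ofDegree_two_eq (hS : IsSmoothProjective 2 A.X) (hK : IsSmoothProjective m K)
    (hH : IsHilbertSchemeOfPoints n A.X H Ξ) (hact : IsTranslationAction Ξ act) (h1 : ∀ w : complexBetti K 1, w = 0)
    (ℓ : complexBetti H 2) :
    ∃ x : complexBetti A.X 2, complexBetti.map (kummerCover act j) 2 ℓ =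
        complexBetti.map (fst A.X K) 2 x + complexBetti.map (snd A.X K) 2 (complexBetti.map j 2 ℓ) ∧
      totalPullback ℂ (AlgPoints.mapContinuous (L := ℂ) (kummerCover act j)) (ofDegree ℂ (ComplexPoints H) 2 ℓ) =
        ofDegree ℂ (ComplexPoints (A.X ⊗ K)) 2
          (complexBetti.map (fst A.X K) 2 x + complexBetti.map (snd A.X K) 2 (complexBetti.map j 2 ℓ)) := by
  obtain ⟨x, hx⟩ := exists_map_kummerCover_two_eq hS hK hH hact h1 ℓ
  exact ⟨x, hx, by rw [totalPullback_lof, ← hx]⟩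

/-! ### §2 The fibre range is a sub-`(L, h, Λ)`-module -/

section FibreRange

variable {G : Type} [Group G] [Fintype G] [MulAction G (ComplexPoints (A.X ⊗ K))]
  (c : FiniteDeckCover G (ComplexPoints (A.X ⊗ K)) (ComplexPoints H))
  (hc : c.proj = AlgPoints.mapContinuous (L := ℂ) (kummerCover act j))
  (hdeck : ∀ g : G, ∃ (b : 𝟙_ (SchemeOver ℂ) ⟶ A.X) (τ : K ⟶ K),
    c.deck g = AlgPoints.mapContinuous (L := ℂ) (A.translate b⁻¹ ⊗ₘ τ))

include hc hdeck in
/-- **`θ^* ℓ ∈ R`** (indeed `im θ^* = R`). -/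
theorem totalPullback_mem_fibreRange (hS : IsSmoothProjective 2 A.X) (hK : IsSmoothProjective m K)
    (hH : IsHilbertSchemeOfPoints n A.X H Ξ) (hact : IsTranslationAction Ξ act) (w : totalCohomology ℂ (ComplexPoints H)) :
    totalPullback ℂ (AlgPoints.mapContinuous (L := ℂ) j) w ∈ fibreRange A K (kummerCover act j) := by
  rw [fibreRange_eq_range c hc hdeck hS hK hH hact]
  exact ⟨w, rfl⟩

include hc hdeck in
/-- **`R` is cup-closed** (it is the image of the ring homomorphism `θ^*`). -/
theorem isCupClosed_fibreRange (hS : IsSmoothProjective 2 A.X) (hK : IsSmoothProjective m K)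
    (hH : IsHilbertSchemeOfPoints n A.X H Ξ) (hact : IsTranslationAction Ξ act) :
    IsCupClosed (fibreRange A K (kummerCover act j)) := by
  rw [fibreRange_eq_range c hc hdeck hS hK hH hact]
  rintro _ ⟨v, rfl⟩ _ ⟨w, rfl⟩
  exact ⟨totalCup ℂ _ v w, totalPullback_totalCup _ v w⟩

include hc hdeck in
/-- **`R` is stable under the degree operator** (`θ^*` preserves degrees). -/
theorem degreeOperator_mem_fibreRange (hS : IsSmoothProjective 2 A.X) (hK : IsSmoothProjective m K)
    (hH : IsHilbertSchemeOfPoints n A.X H Ξ) (hact : IsTranslationAction Ξ act) (N : ℕ)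
    {s : totalCohomology ℂ (ComplexPoints K)} (hs : s ∈ fibreRange A K (kummerCover act j)) :
    degreeOperator ℂ (ComplexPoints K) N s ∈ fibreRange A K (kummerCover act j) := by
  rw [fibreRange_eq_range c hc hdeck hS hK hH hact] at hs ⊢
  obtain ⟨w, rfl⟩ := hs
  exact ⟨degreeOperator ℂ _ N w, (degreeOperator_totalPullback _ N w).symm⟩

/-- **Deck factors fix the fibre range pointwise**: if `d_g^* ∘ κ = κ ∘ (id ⊗ τ^*)` and `s ∈ R`, then `τ^* s = s`
(apply the slice `(1, 𝟙_K)` to `d_g^* (1 × s) = 1 × s`). -/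
theorem totalPullback_eq_self_of_mem_fibreRange {Θ : A.X ⊗ K ⟶ H} (hc' : c.proj = AlgPoints.mapContinuous (L := ℂ) Θ)
    {g : G} {τ : K ⟶ K}
    (hτ : ∀ x, totalPullback ℂ (c.deck g) (kunnethCross A.X K x) =
      kunnethCross A.X K ((totalPullback ℂ (AlgPoints.mapContinuous (L := ℂ) τ)).lTensor _ x))
    {s : totalCohomology ℂ (ComplexPoints K)} (hs : s ∈ fibreRange A K Θ) :
    totalPullback ℂ (AlgPoints.mapContinuous (L := ℂ) τ) s = s := by
  rw [mem_fibreRange_iff, ← hc', mem_range_totalPullback_proj_iff] at hs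
  have h1 := hs g
  rw [hτ, LinearMap.lTensor_tmul] at h1
  have h2 := congrArg (totalPullback ℂ (AlgPoints.mapContinuous (L := ℂ)
    (Motives.sliceRight (1 : 𝟙_ (SchemeOver ℂ) ⟶ A.X) K))) h1
  rwa [totalPullback_sliceRight_kunnethCross_one_tmul, totalPullback_sliceRight_kunnethCross_one_tmul] at h2

/-- Conversely, membership in `R` is checked deck-factor-wise: if for every `g` the `K`-factor `τ_g^*` of `d_g^*` fixes
`s`, then `s ∈ R`. -/
theorem mem_fibreRange_of_forall {Θ : A.X ⊗ K ⟶ H} (hc' : c.proj = AlgPoints.mapContinuous (L := ℂ) Θ)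
    {s : totalCohomology ℂ (ComplexPoints K)}
    (hs : ∀ g : G, ∃ τ : K ⟶ K, (∀ x, totalPullback ℂ (c.deck g) (kunnethCross A.X K x) =
        kunnethCross A.X K ((totalPullback ℂ (AlgPoints.mapContinuous (L := ℂ) τ)).lTensor _ x)) ∧
      totalPullback ℂ (AlgPoints.mapContinuous (L := ℂ) τ) s = s) :
    s ∈ fibreRange A K Θ := by
  rw [mem_fibreRange_iff, ← hc', mem_range_totalPullback_proj_iff]
  intro g
  obtain ⟨τ, hτ, hτs⟩ := hs g
  rw [hτ, LinearMap.lTensor_tmul, hτs]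

/-- **A deck factor `τ^*` commutes with every dual Lefschetz operator of a class it fixes** (`τ^*` is a degree-
preserving ring endomorphism of `H*(K)`, so it intertwines `(h, L_y)` with itself; naturality of the
`𝔰𝔩₂`-partner, `Algebra.Lie.comp_dual_eq_dual_comp_of_isSl2Triple`). -/
theorem totalPullback_comp_lambda_eq (hK : IsSmoothProjective m K) (τ : K ⟶ K) {N : ℕ} {y : complexBetti K 2}
    (hy : complexBetti.map τ 2 y = y) {Λ : Module.End ℂ (totalCohomology ℂ (ComplexPoints K))}
    (hΛ : IsDualLefschetz N y Λ) :
    totalPullback ℂ (AlgPoints.mapContinuous (L := ℂ) τ) ∘ₗ Λ = Λ ∘ₗ totalPullback ℂ (AlgPoints.mapContinuous (L := ℂ) τ) := by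
  haveI := finite_totalCohomology hK
  have hh : totalPullback ℂ (AlgPoints.mapContinuous (L := ℂ) τ) ∘ₗ degreeOperator ℂ (ComplexPoints K) N =
      degreeOperator ℂ (ComplexPoints K) N ∘ₗ totalPullback ℂ (AlgPoints.mapContinuous (L := ℂ) τ) :=
    LinearMap.ext fun w ↦ (degreeOperator_totalPullback _ N w).symm
  have he : totalPullback ℂ (AlgPoints.mapContinuous (L := ℂ) τ) ∘ₗ totalLefschetz y =
      totalLefschetz y ∘ₗ totalPullback ℂ (AlgPoints.mapContinuous (L := ℂ) τ) := by
    refine LinearMap.ext fun w ↦ ?_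
    simp only [LinearMap.coe_comp, Function.comp_apply]
    rw [← totalLefschetz_totalPullback]
    change totalLefschetz (complexBetti.map τ 2 y) _ = _
    rw [hy]
  exact Literature.Algebra.Lie.comp_dual_eq_dual_comp_of_isSl2Triple (isZGrading_degreeOperator N)
    (isZGrading_degreeOperator N) hΛ hΛ (totalPullback ℂ (AlgPoints.mapContinuous (L := ℂ) τ)) hh he

include hc hdeck in
/-- **`R` is stable under every dual Lefschetz operator of `θ^* ℓ`** (`ℓ ∈ H²(H)`; `K` smooth projective): for
`s ∈ R` and a deck factor `τ_g`, `τ_g^* (Λ s) = Λ (τ_g^* s) = Λ s`. -/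
theorem lambda_mem_fibreRange (hS : IsSmoothProjective 2 A.X) (hK : IsSmoothProjective m K)
    (hH : IsHilbertSchemeOfPoints n A.X H Ξ) (hact : IsTranslationAction Ξ act) {N : ℕ} (ℓ : complexBetti H 2)
    {Λ : Module.End ℂ (totalCohomology ℂ (ComplexPoints K))} (hΛ : IsDualLefschetz N (complexBetti.map j 2 ℓ) Λ)
    {s : totalCohomology ℂ (ComplexPoints K)} (hs : s ∈ fibreRange A K (kummerCover act j)) :
    Λ s ∈ fibreRange A K (kummerCover act j) := by
  refine mem_fibreRange_of_forall c hc fun g ↦ ?_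
  obtain ⟨τ, hτ⟩ := exists_totalPullback_deck_kunnethCross c hdeck g
  refine ⟨τ, hτ, ?_⟩
  -- `τ^*` fixes `θ^* ℓ` (it lies in `R`) and `s`
  have hy : complexBetti.map τ 2 (complexBetti.map j 2 ℓ) = complexBetti.map j 2 ℓ := by
    have h2 := totalPullback_eq_self_of_mem_fibreRange c hc hτ
      (totalPullback_mem_fibreRange c hc hdeck hS hK hH hact (ofDegree ℂ _ 2 ℓ))
    rw [totalPullback_lof, totalPullback_lof] at h2
    exact DirectSum.of_injective (β := fun k ↦ complexBetti K k) 2 h2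
  have hs' := totalPullback_eq_self_of_mem_fibreRange c hc hτ hs
  rw [← LinearMap.comp_apply, totalPullback_comp_lambda_eq hK τ hy hΛ, LinearMap.comp_apply, hs']

end FibreRange

/-! ### §3 Small facts: `n = 0` is vacuous; `h_K ≠ 0` on `R` for `n ≥ 1` -/

/-- For `K` smooth projective of dimension `0` the degree operator `h_K` (dimension `0`) vanishes (`Hᵏ(K) = 0` for
`k > 0`, and `h = k - 0 = 0` on `H⁰`) — so no class of `K` has a dual Lefschetz operator and V0 is vacuous at `n = 0`. -/
theorem degreeOperator_eq_zero_of_dim_zero (hK : IsSmoothProjective 0 K) :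
    degreeOperator ℂ (ComplexPoints K) 0 = 0 := by
  refine DirectSum.linearMap_ext ℂ fun k ↦ LinearMap.ext fun x ↦ ?_
  simp only [LinearMap.coe_comp, Function.comp_apply, LinearMap.zero_apply]
  change degreeOperator ℂ (ComplexPoints K) 0 (ofDegree ℂ _ k x) = 0
  rw [degreeOperator_lof]
  rcases Nat.eq_zero_or_pos k with rfl | hk
  · simp
  · haveI := subsingleton_complexBetti hK (k := k) (by omega)
    rw [Subsingleton.elim x 0, map_zero, smul_zero]

/-- Hence `IsDualLefschetz (2 * 0) y Λ` is impossible. -/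
theorem not_isDualLefschetz_of_dim_zero (hK : IsSmoothProjective (2 * 0) K) (y : complexBetti K 2)
    (Λ : Module.End ℂ (totalCohomology ℂ (ComplexPoints K))) : ¬ IsDualLefschetz (2 * 0) y Λ := fun h ↦
  ((isDualLefschetz_iff _ y Λ).1 h).1 (by rw [Nat.mul_zero]; exact degreeOperator_eq_zero_of_dim_zero (by simpa using hK))

/-- `h_K (1) = -2n • 1 ≠ 0` for `K` smooth projective of dimension `2n`, `n ≥ 1` (so `h_K ≠ 0` on any submodule
containing `1`). -/
theorem degreeOperator_one_ne_zero (hK : IsSmoothProjective (2 * n) K) (hn : 1 ≤ n) :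
    degreeOperator ℂ (ComplexPoints K) (2 * n)
      (ofDegree ℂ (ComplexPoints K) 0 (singularCohomology.one ℂ (ComplexPoints K))) ≠ 0 := by
  have h1 : singularCohomology.one ℂ (ComplexPoints K) ≠ 0 := by
    intro h0
    obtain ⟨c, hc⟩ := exists_eq_smul_one_of_isSmoothProjective hK ℂ (singularCohomology.one ℂ (ComplexPoints K))
    have hall : ∀ b : complexBetti K 0, b = 0 := fun b ↦ by
      obtain ⟨d, hd⟩ := exists_eq_smul_one_of_isSmoothProjective hK ℂ b; rw [hd, h0, smul_zero]
    haveI : Subsingleton (complexBetti K 0) := ⟨fun a b ↦ by rw [hall a, hall b]⟩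
    have := Literature.AlgebraicGeometry.Surfaces.finrank_complexBetti_zero hK
    rw [Module.finrank_zero_of_subsingleton] at this
    exact zero_ne_one this
  intro h0
  rw [degreeOperator_lof] at h0
  rcases smul_eq_zero.1 h0 with h2 | h2
  · have : ((0 : ℕ) : ℂ) - ((2 * n : ℕ) : ℂ) ≠ 0 := by
      rw [sub_ne_zero]; exact_mod_cast (by omega : (0 : ℕ) ≠ 2 * n)
    exact this h2
  · exact h1 (DirectSum.of_injective (β := fun k ↦ (complexBetti K k : Type)) 0
      (h2.trans (map_zero (ofDegree ℂ (ComplexPoints K) 0)).symm))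

end Summit.Ventures.HodgeKum4.HilbertKummer

end
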